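import Summits.CriticalPhenomena.PercolationContinuityZ3.Theorems.Transplant.FKConnectivityAllQForestAdjacentTwoSumSameSide
import HarnessLib

/-!
# Same-side 2-sums, fibre form: the node for `(M₁, u₁)`, `(M₁ + ab, u₁)` and `(M₁, u₁ + ab)` on side 1 implies the node for the 2-sum

Support file (`--supports stmt-CriticalPhenomena-4575`), FK sub-lane `prim-bschramm-fk-1` (gen 22) of the post-continuity programme;
builds on p205010 (kernel theorem, internal audit signed; external expert review pending).  No definitions, no named facts, no sorries;
standard axioms.

`adjForestNoSq_fibre_of_twoSep_sameSide` (`…ForestAdjacentTwoSumSameSide`) takes its three side-1 hypotheses in SPLIT form (counts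
restricted by `a ↮ b`).  THIS FILE identifies them with the node's inequality (`AdjForestRayleighNoSqOn`-shape) on three genuine fibres
of the vertex type: the side-1 fibre `(M₁, u₁) = (M ∩ E₁, u ∩ E₁)`, the fibre `(M₁ ∪ {ab}, u₁)` with the virtual pair `ab` FREE, and the
fibre `(M₁, u₁ ∪ {ab})` with `ab` PINNED (doubled), when `ab` is not a side-1 pair (`s(a,b) ∉ E₁`; an existing pair `ab` of the glued
fibre is simply assigned to side 2):
* `insert_symmDiff_of_notMem_right`, `sdiff_singleton_symmDiff_of_notMem` — partner bookkeeping for one pair outside `M`;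
* **`fibreCount_insert_pinned`** — `#_{(M, u ∪ {g})}(P, Q) = #_{(M,u)}({ω | ω ∪ {g} ∈ P}, {ζ | ζ ∪ {g} ∈ Q})` for `g ∉ M ∪ u`;
* **`adjForestNoSq_fibre_of_twoSep_sameSide_fibres`** — THE SAME-SIDE 2-SUM CLOSURE in fibre form.
Consequence (with g18's `adjForestNoSq_fibre_of_twoSep` for pairs on different sides and `adjForestNoSq_fibre_eq_of_cutVertex`): every
2-separation of the pair graph of a fibre reduces the node to fibres with fewer pairs — a minimal counterexample to
`AdjForestRayleighNoSqPos` is 3-connected (memo bschramm/FROM-fk-1-g18-VERTEX-NC.md §4b, now kernel-complete at the level of the two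
reduction theorems; memo bschramm/FROM-fk-1-g22-EARS.md §4).
[cite: Wagner2006, Thm. 5.8, §5.3 (pp. 14–15)] [cite: SempleWelsh2008, Prop. 4.1 (p. 11); Conj. 1.1 (p. 2)] [cite: Linusson2011, Prop. 2.6]
-/

noncomputable section

namespace Summit.CriticalPhenomena.PercolationContinuityZ3.Theorems

namespace FK

open Set Literature.Probability.LatticeModels Literature.Probability.Percolation
open scoped Classical symmDiff

/-! ### One pinned pair more -/

section Pinned

variable {V : Type*} {M u : BondConfig V} {g : Sym2 V}

/-- `(ω ∪ {g}) ∆ M = (ω ∆ M) ∪ {g}` for `g ∉ M`. [folklore] -/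
theorem insert_symmDiff_of_notMem_right {ω : BondConfig V} (hgM : g ∉ M) : insert g ω ∆ M = insert g (ω ∆ M) := by
  ext x; simp only [Set.mem_symmDiff, mem_insert_iff]
  by_cases hx : x = g
  · subst hx; tauto
  · tauto

/-- `(ω ∖ {g}) ∆ M = (ω ∆ M) ∖ {g}` for `g ∉ M`. [folklore] -/
theorem sdiff_singleton_symmDiff_of_notMem {ω : BondConfig V} (hgM : g ∉ M) : (ω \ {g}) ∆ M = (ω ∆ M) \ {g} := by
  ext x; simp only [Set.mem_symmDiff, mem_sdiff, mem_singleton_iff]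
  by_cases hx : x = g
  · subst hx; tauto
  · tauto

variable [Fintype V]

/-- **One pair inserted into the pinned part**: for `g ∉ M ∪ u`,
`#_{(M, u ∪ {g})}(P, Q) = #_{(M,u)}({ω | ω ∪ {g} ∈ P}, {ζ | ζ ∪ {g} ∈ Q})` (the bijection `ω ↦ ω ∪ {g}`; the pinned pair lies in the
configuration and in its partner). [cite: Linusson2011, Prop. 2.6] -/
theorem fibreCount_insert_pinned (hgM : g ∉ M) (hgu : g ∉ u) (P Q : Set (BondConfig V)) :
    fibreCount M (insert g u) P Q = fibreCount M u {ω | insert g ω ∈ P} {ζ | insert g ζ ∈ Q} := by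
  symm
  refine fibreCount_eq_of_bij (fun ω => insert g ω) (fun ω => ω \ {g}) (fun ω hω hA hB => ?_) (fun ω hω hA hB => ?_)
  · have hgω : g ∉ ω := fun h => hgu (by rw [← hω]; exact ⟨h, hgM⟩)
    refine ⟨by rw [insert_sdiff_of_notMem _ hgM, hω], hA, ?_, insert_sdiff_self_of_notMem hgω⟩
    show insert g ω ∆ M ∈ Q
    rw [insert_symmDiff_of_notMem_right hgM]; exact hB
  · have hgω : g ∈ ω := by
      have : g ∈ ω \ M := by rw [hω]; exact mem_insert _ _
      exact this.1
    have hback : insert g (ω \ {g}) = ω := insert_sdiff_self_of_mem hgω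
    refine ⟨?_, ?_, ?_, hback⟩
    · rw [Set.sdiff_sdiff_comm, hω, insert_sdiff_self_of_notMem hgu]
    · show insert g (ω \ {g}) ∈ P
      rw [hback]; exact hA
    · show insert g ((ω \ {g}) ∆ M) ∈ Q
      rw [sdiff_singleton_symmDiff_of_notMem hgM, insert_sdiff_self_of_mem (Set.mem_symmDiff.2 (Or.inl ⟨hgω, hgM⟩))]
      exact hB

end Pinned

/-! ### The same-side 2-sum closure, fibre form -/

section SameSideFibres

variable {V : Type*} [Fintype V] {E₁ E₂ : Set (Sym2 V)} {V₁ V₂ : Set V} {a b : V} {M u : BondConfig V} {e f : Sym2 V}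

/-- **(♣)⁰ across a 2-separation with both pairs on one side, fibre form.**  Setting of
`adjForestNoSq_fibre_of_twoSep_sameSide`, with the virtual pair `ab` not a side-1 pair (`s(a,b) ∉ E₁`).  If the node's inequality
`#(Fo ∩ {e,f ∈ ω}, Fo) ≤ #(Fo ∩ {e ∈ ω}, Fo ∩ {f ∈ ω})` holds on the three side-1 fibres `(M ∩ E₁, u ∩ E₁)`,
`((M ∩ E₁) ∪ {ab}, u ∩ E₁)` and `(M ∩ E₁, (u ∩ E₁) ∪ {ab})`, then it holds on `(M, u)`.
[cite: Wagner2006, Thm. 5.8, §5.3 (pp. 14–15)] [cite: SempleWelsh2008, Conj. 1.1 (p. 2)] [cite: Linusson2011, Prop. 2.6] -/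
theorem adjForestNoSq_fibre_of_twoSep_sameSide_fibres (h₁ : ∀ g ∈ E₁, ∀ z ∈ g, z ∈ V₁) (h₂ : ∀ g ∈ E₂, ∀ z ∈ g, z ∈ V₂)
    (hS : V₁ ∩ V₂ ⊆ {a, b}) (hab : a ≠ b) (hd : Disjoint E₁ E₂) (hMu : M ∪ u ⊆ E₁ ∪ E₂) (he : e ∈ M ∩ E₁) (hf : f ∈ M ∩ E₁)
    (hgE : s(a, b) ∉ E₁)
    (K0 : fibreCount (M ∩ E₁) (u ∩ E₁) (forestEv V ∩ {ω | e ∈ ω ∧ f ∈ ω}) (forestEv V) ≤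
      fibreCount (M ∩ E₁) (u ∩ E₁) (forestEv V ∩ {ω | e ∈ ω}) (forestEv V ∩ {ω | f ∈ ω}))
    (K1 : fibreCount (insert s(a, b) (M ∩ E₁)) (u ∩ E₁) (forestEv V ∩ {ω | e ∈ ω ∧ f ∈ ω}) (forestEv V) ≤
      fibreCount (insert s(a, b) (M ∩ E₁)) (u ∩ E₁) (forestEv V ∩ {ω | e ∈ ω}) (forestEv V ∩ {ω | f ∈ ω}))
    (K2 : fibreCount (M ∩ E₁) (insert s(a, b) (u ∩ E₁)) (forestEv V ∩ {ω | e ∈ ω ∧ f ∈ ω}) (forestEv V) ≤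
      fibreCount (M ∩ E₁) (insert s(a, b) (u ∩ E₁)) (forestEv V ∩ {ω | e ∈ ω}) (forestEv V ∩ {ω | f ∈ ω})) :
    fibreCount M u (forestEv V ∩ {ω | e ∈ ω ∧ f ∈ ω}) (forestEv V) ≤
      fibreCount M u (forestEv V ∩ {ω | e ∈ ω}) (forestEv V ∩ {ω | f ∈ ω}) := by
  have hgM : s(a, b) ∉ M ∩ E₁ := fun h => hgE h.2
  have hgu : s(a, b) ∉ u ∩ E₁ := fun h => hgE h.2
  have heg : e ≠ s(a, b) := fun h => hgE (h ▸ he.2)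
  have hfg : f ≠ s(a, b) := fun h => hgE (h ▸ hf.2)
  -- on the side-1 fibre the virtual pair is absent from both classes
  have hgω : ∀ {ω : BondConfig V}, ω \ (M ∩ E₁) = u ∩ E₁ → s(a, b) ∉ ω := fun {ω} hω h =>
    ((mem_union_of_fibre hω h).elim hgM hgu)
  have hgζ : ∀ {ω : BondConfig V}, ω \ (M ∩ E₁) = u ∩ E₁ → s(a, b) ∉ ω ∆ (M ∩ E₁) := fun {ω} hω h =>
    ((mem_union_of_fibre_symmDiff hω h).elim hgM hgu)
  -- `ω ∪ {ab} ∈ Fo ↔ ω ∈ Fo ∧ a ↮ b`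
  have hins : ∀ {ω : BondConfig V}, s(a, b) ∉ ω → (IsForestCfg (insert s(a, b) ω) ↔ IsForestCfg ω ∧ ¬ (openGraph ω).Reachable a b) :=
    fun h => isForestCfg_insert_iff hab h
  have hmem_e : ∀ {ω : BondConfig V}, e ∈ insert s(a, b) ω ↔ e ∈ ω := fun {ω} =>
    ⟨fun h => (mem_insert_iff.1 h).resolve_left heg, fun h => mem_insert_of_mem _ h⟩
  have hmem_f : ∀ {ω : BondConfig V}, f ∈ insert s(a, b) ω ↔ f ∈ ω := fun {ω} =>
    ⟨fun h => (mem_insert_iff.1 h).resolve_left hfg, fun h => mem_insert_of_mem _ h⟩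
  refine adjForestNoSq_fibre_of_twoSep_sameSide h₁ h₂ hS hab hd hMu he hf K0 ?_ ?_
  · -- H1 from K1: the free virtual pair goes to the configuration or to its partner
    rw [fibreCount_insert_one hgM, fibreCount_insert_one hgM] at K1
    have e1 : fibreCount (M ∩ E₁) (u ∩ E₁) ({ω | s(a, b) ∉ ω} ∩ {ω | insert s(a, b) ω ∈ forestEv V ∩ {ω | e ∈ ω ∧ f ∈ ω}})
        ({ω | s(a, b) ∉ ω} ∩ forestEv V) =
        fibreCount (M ∩ E₁) (u ∩ E₁) (forestEv V ∩ {ω | e ∈ ω ∧ f ∈ ω} ∩ {ω | ¬ (openGraph ω).Reachable a b}) (forestEv V) :=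
      fibreCount_congr_fibre _ _ fun ω hω => by
        simp only [mem_inter_iff, mem_setOf_eq, forestEv, hins (hgω hω), hmem_e, hmem_f, hgω hω, hgζ hω, not_false_eq_true, true_and]
        tauto
    have e2 : fibreCount (M ∩ E₁) (u ∩ E₁) ({ω | s(a, b) ∉ ω} ∩ (forestEv V ∩ {ω | e ∈ ω ∧ f ∈ ω}))
        ({ω | s(a, b) ∉ ω} ∩ {ω | insert s(a, b) ω ∈ forestEv V}) =
        fibreCount (M ∩ E₁) (u ∩ E₁) (forestEv V ∩ {ω | e ∈ ω ∧ f ∈ ω}) (forestEv V ∩ {ω | ¬ (openGraph ω).Reachable a b}) :=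
      fibreCount_congr_fibre _ _ fun ω hω => by
        simp only [mem_inter_iff, mem_setOf_eq, forestEv, hins (hgζ hω), hgω hω, hgζ hω, not_false_eq_true, true_and]
    have e3 : fibreCount (M ∩ E₁) (u ∩ E₁) ({ω | s(a, b) ∉ ω} ∩ {ω | insert s(a, b) ω ∈ forestEv V ∩ {ω | e ∈ ω}})
        ({ω | s(a, b) ∉ ω} ∩ (forestEv V ∩ {ω | f ∈ ω})) =
        fibreCount (M ∩ E₁) (u ∩ E₁) (forestEv V ∩ {ω | e ∈ ω} ∩ {ω | ¬ (openGraph ω).Reachable a b}) (forestEv V ∩ {ω | f ∈ ω}) :=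
      fibreCount_congr_fibre _ _ fun ω hω => by
        simp only [mem_inter_iff, mem_setOf_eq, forestEv, hins (hgω hω), hmem_e, hgω hω, hgζ hω, not_false_eq_true, true_and]
        tauto
    have e4 : fibreCount (M ∩ E₁) (u ∩ E₁) ({ω | s(a, b) ∉ ω} ∩ (forestEv V ∩ {ω | e ∈ ω}))
        ({ω | s(a, b) ∉ ω} ∩ {ω | insert s(a, b) ω ∈ forestEv V ∩ {ω | f ∈ ω}}) =
        fibreCount (M ∩ E₁) (u ∩ E₁) (forestEv V ∩ {ω | e ∈ ω}) (forestEv V ∩ {ω | f ∈ ω} ∩ {ω | ¬ (openGraph ω).Reachable a b}) :=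
      fibreCount_congr_fibre _ _ fun ω hω => by
        simp only [mem_inter_iff, mem_setOf_eq, forestEv, hins (hgζ hω), hmem_f, hgω hω, hgζ hω, not_false_eq_true, true_and]
        tauto
    rw [e1, e2, e3, e4] at K1
    exact K1
  · -- H2 from K2: the pinned virtual pair lies in both classes
    rw [fibreCount_insert_pinned hgM hgu, fibreCount_insert_pinned hgM hgu] at K2
    have e5 : fibreCount (M ∩ E₁) (u ∩ E₁) {ω | insert s(a, b) ω ∈ forestEv V ∩ {ω | e ∈ ω ∧ f ∈ ω}}
        {ζ | insert s(a, b) ζ ∈ forestEv V} =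
        fibreCount (M ∩ E₁) (u ∩ E₁) (forestEv V ∩ {ω | e ∈ ω ∧ f ∈ ω} ∩ {ω | ¬ (openGraph ω).Reachable a b})
          (forestEv V ∩ {ω | ¬ (openGraph ω).Reachable a b}) :=
      fibreCount_congr_fibre _ _ fun ω hω => by
        simp only [mem_inter_iff, mem_setOf_eq, forestEv, hins (hgω hω), hins (hgζ hω), hmem_e, hmem_f]
        tauto
    have e6 : fibreCount (M ∩ E₁) (u ∩ E₁) {ω | insert s(a, b) ω ∈ forestEv V ∩ {ω | e ∈ ω}}
        {ζ | insert s(a, b) ζ ∈ forestEv V ∩ {ω | f ∈ ω}} =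
        fibreCount (M ∩ E₁) (u ∩ E₁) (forestEv V ∩ {ω | e ∈ ω} ∩ {ω | ¬ (openGraph ω).Reachable a b})
          (forestEv V ∩ {ω | f ∈ ω} ∩ {ω | ¬ (openGraph ω).Reachable a b}) :=
      fibreCount_congr_fibre _ _ fun ω hω => by
        simp only [mem_inter_iff, mem_setOf_eq, forestEv, hins (hgω hω), hins (hgζ hω), hmem_e, hmem_f]
        tauto
    rw [e5, e6] at K2
    exact K2

end SameSideFibres

end FK

end Summit.CriticalPhenomena.PercolationContinuityZ3.Theorems

end
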